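import Mathlib
import HarnessLib

/-!
# LatticeQCDFlow / Scaling — three weighted-integral inequalities: the tangent-line Jensen floor
# `(∫K)·e^{(∫K F)/∫K} ≤ ∫K e^F`, the weighted Cauchy–Schwarz `(∫K|T|)² ≤ (∫K)(∫K T²)`, and the
# pair-variance factorisation `∫∫ K(a)K(b)(G(a) − G(b))² = 2(∫K)(∫K G²) − 2(∫K G)²`

HONEST FRAMING: exact (Metropolis-corrected) sampling algorithms for lattice gauge theory;
figures of merit are autocorrelation/cost numbers at stated couplings and volumes; no
continuum-physics claim.

Venture `LatticeQCDFlow` (cell pub-lqcd), topic `Scaling`; FANOUT row 3 (`s0-u1-a`, S0-B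
implementation A, GEN-15).  Folklore-level tools (only linearity and monotonicity of the Bochner
integral and Fubini for product integrands are used), isolated here because the companion files
`Scaling/AcceptanceMidpointLaw` (one block) and `Scaling/AcceptanceVolumeRatePi` (`m` blocks) both
apply them, to the Bhattacharyya midpoint kernel `K = √(p q) ⊗ √(p q)` of a flow sampler.  NO
definition is introduced.  On any measure space `(Ω, M)` with a weight `K ≥ 0`:

* `integrable_mul_exp_of_nonpos` — `K e^F ∈ L¹` for `F ≤ 0` measurable;
* **`integral_mul_exp_ge`** — JENSEN for `exp` under the law `K dM/∫K`, in the division-free form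
  `(∫K)·exp((∫K F)/∫K) ≤ ∫ K e^F` (`F ≤ 0`, `K F ∈ L¹`), from the tangent line
  `e^y ≥ e^c (1 + y − c)` at `c = (∫K F)/∫K`;
* `integrable_mul_abs_of_sq`, `integrable_mul_of_sq` — `K|T|, K T ∈ L¹` once `K, K T² ∈ L¹`;
  **`sq_integral_mul_abs_le`** — `(∫K|T|)² ≤ (∫K)·(∫K T²)` (discriminant of
  `s ↦ ∫K(|T| − s)² ≥ 0`; the degenerate case `∫K = 0` included);
* **`integral_prod_mul_mul_sq_sub`** (`M` s-finite) —
  `∫ K(a)K(b)(G(a) − G(b))² d(M⊗M) = 2(∫K)(∫K G²) − 2(∫K G)²`, i.e. for the probability law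
  `K dM/∫K` the mean square gap of two independent draws is twice the variance.

NOT CLAIMED: anything about samplers; no number of ours.
-/

namespace Summit.Ventures.LatticeQCDFlow.Theory2

open MeasureTheory Filter

/-! ## Weighted-integral inequalities on a general measure space -/

section Generic

variable {Ω : Type*} [MeasurableSpace Ω] {M : Measure Ω}

/-- `K·e^F` is integrable for an integrable weight `K ≥ 0` and a measurable `F ≤ 0` (it is dominated
by `K`). [folklore] -/
theorem integrable_mul_exp_of_nonpos {K F : Ω → ℝ} (hK0 : ∀ ω, 0 ≤ K ω) (hKi : Integrable K M)
    (hFm : Measurable F) (hF0 : ∀ ω, F ω ≤ 0) :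
    Integrable (fun ω => K ω * Real.exp (F ω)) M := by
  refine hKi.mono' (hKi.aestronglyMeasurable.mul hFm.exp.aestronglyMeasurable)
    (Eventually.of_forall fun ω => ?_)
  rw [Real.norm_of_nonneg (mul_nonneg (hK0 ω) (Real.exp_nonneg _))]
  exact mul_le_of_le_one_right (hK0 ω) (Real.exp_le_one_iff.2 (hF0 ω))

/-- **Tangent-line Jensen floor for the exponential under a weight.**  For an integrable weight
`K ≥ 0` of positive mass `Z = ∫K` and a measurable `F ≤ 0` with `K·F` integrable,
`Z·exp((∫ K F)/Z) ≤ ∫ K e^F` (Jensen for the probability law `K dM/Z`, proved from the tangent line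
`e^y ≥ e^c(1 + y − c)` at `c = (∫K F)/Z`, so that only linearity of the integral is used).
[folklore] -/
theorem integral_mul_exp_ge {K F : Ω → ℝ} (hK0 : ∀ ω, 0 ≤ K ω) (hKi : Integrable K M)
    (hZ : 0 < ∫ ω, K ω ∂M) (hFm : Measurable F) (hF0 : ∀ ω, F ω ≤ 0)
    (hKF : Integrable (fun ω => K ω * F ω) M) :
    (∫ ω, K ω ∂M) * Real.exp ((∫ ω, K ω * F ω ∂M) / ∫ ω, K ω ∂M)
      ≤ ∫ ω, K ω * Real.exp (F ω) ∂M := by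
  set Z := ∫ ω, K ω ∂M with hZdef
  set c := (∫ ω, K ω * F ω ∂M) / Z with hcdef
  have hKexp := integrable_mul_exp_of_nonpos hK0 hKi hFm hF0
  -- the tangent line of `exp` at `c`, weighted by `K ≥ 0`
  have hpt : ∀ ω, Real.exp c * (1 - c) * K ω + Real.exp c * (K ω * F ω) ≤ K ω * Real.exp (F ω) := by
    intro ω
    have h := Real.add_one_le_exp (F ω - c)
    have h' : Real.exp c * (1 + (F ω - c)) ≤ Real.exp (F ω) := by
      calc Real.exp c * (1 + (F ω - c)) ≤ Real.exp c * Real.exp (F ω - c) :=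
            mul_le_mul_of_nonneg_left (by linarith) (Real.exp_nonneg _)
        _ = Real.exp (F ω) := by rw [← Real.exp_add]; ring_nf
    have := mul_le_mul_of_nonneg_left h' (hK0 ω)
    linarith [this]
  have hlin : Integrable (fun ω => Real.exp c * (1 - c) * K ω + Real.exp c * (K ω * F ω)) M :=
    (hKi.const_mul _).add (hKF.const_mul _)
  have hcZ : ∫ ω, K ω * F ω ∂M = c * Z := by rw [hcdef, div_mul_cancel₀ _ hZ.ne']
  calc Z * Real.exp c
      = ∫ ω, Real.exp c * (1 - c) * K ω + Real.exp c * (K ω * F ω) ∂M := by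
        rw [integral_add (hKi.const_mul _) (hKF.const_mul _), integral_const_mul,
          integral_const_mul, hcZ]
        ring
    _ ≤ ∫ ω, K ω * Real.exp (F ω) ∂M := integral_mono hlin hKexp hpt

/-- `K·|T|` is integrable once `K ≥ 0` and `K·T²` are (`|T| ≤ 1 + T²`). [folklore] -/
theorem integrable_mul_abs_of_sq {K T : Ω → ℝ} (hK0 : ∀ ω, 0 ≤ K ω) (hKi : Integrable K M)
    (hTm : Measurable T) (hKT2 : Integrable (fun ω => K ω * T ω ^ 2) M) :
    Integrable (fun ω => K ω * |T ω|) M := by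
  refine (hKi.add hKT2).mono' (hKi.aestronglyMeasurable.mul hTm.abs.aestronglyMeasurable)
    (Eventually.of_forall fun ω => ?_)
  rw [Real.norm_of_nonneg (mul_nonneg (hK0 ω) (abs_nonneg _))]
  have h1 : |T ω| ≤ 1 + T ω ^ 2 := by nlinarith [abs_nonneg (T ω), sq_abs (T ω)]
  calc K ω * |T ω| ≤ K ω * (1 + T ω ^ 2) := mul_le_mul_of_nonneg_left h1 (hK0 ω)
    _ = K ω + K ω * T ω ^ 2 := by ring

/-- `K·T` is integrable once `K ≥ 0` and `K·T²` are. [folklore] -/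
theorem integrable_mul_of_sq {K T : Ω → ℝ} (hK0 : ∀ ω, 0 ≤ K ω) (hKi : Integrable K M)
    (hTm : Measurable T) (hKT2 : Integrable (fun ω => K ω * T ω ^ 2) M) :
    Integrable (fun ω => K ω * T ω) M := by
  refine (integrable_mul_abs_of_sq hK0 hKi hTm hKT2).mono'
    (hKi.aestronglyMeasurable.mul hTm.aestronglyMeasurable) (Eventually.of_forall fun ω => ?_)
  rw [norm_mul, Real.norm_of_nonneg (hK0 ω), Real.norm_eq_abs]

/-- **Weighted Cauchy–Schwarz.**  For an integrable weight `K ≥ 0` and a measurable `T` with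
`K·T²` integrable: `(∫ K|T|)² ≤ (∫ K)·(∫ K T²)` (the discriminant of `s ↦ ∫ K(|T| − s)² ≥ 0`).
[folklore] -/
theorem sq_integral_mul_abs_le {K T : Ω → ℝ} (hK0 : ∀ ω, 0 ≤ K ω) (hKi : Integrable K M)
    (hTm : Measurable T) (hKT2 : Integrable (fun ω => K ω * T ω ^ 2) M) :
    (∫ ω, K ω * |T ω| ∂M) ^ 2 ≤ (∫ ω, K ω ∂M) * ∫ ω, K ω * T ω ^ 2 ∂M := by
  set Z := ∫ ω, K ω ∂M with hZdef
  set A := ∫ ω, K ω * |T ω| ∂M with hAdef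
  set Q := ∫ ω, K ω * T ω ^ 2 ∂M with hQdef
  have hKT := integrable_mul_abs_of_sq hK0 hKi hTm hKT2
  have hA0 : 0 ≤ A := integral_nonneg fun ω => mul_nonneg (hK0 ω) (abs_nonneg _)
  have hZ0 : 0 ≤ Z := integral_nonneg hK0
  -- the quadratic `s ↦ ∫ K (|T| - s)² = Q - 2 s A + s² Z` is nonnegative
  have key : ∀ s : ℝ, 0 ≤ Q - 2 * s * A + s ^ 2 * Z := by
    intro s
    have e : ∀ ω, K ω * (|T ω| - s) ^ 2 = K ω * T ω ^ 2 - 2 * s * (K ω * |T ω|) + s ^ 2 * K ω := by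
      intro ω; rw [sub_sq, sq_abs]; ring
    have h0 : 0 ≤ ∫ ω, K ω * (|T ω| - s) ^ 2 ∂M :=
      integral_nonneg fun ω => mul_nonneg (hK0 ω) (sq_nonneg _)
    simp_rw [e] at h0
    have hA : Integrable (fun ω => K ω * T ω ^ 2 - 2 * s * (K ω * |T ω|)) M :=
      hKT2.sub (hKT.const_mul _)
    rwa [integral_add hA (hKi.const_mul _), integral_sub hKT2 (hKT.const_mul _),
      integral_const_mul, integral_const_mul] at h0
  rcases hZ0.eq_or_lt with hZ | hZ
  · -- `Z = 0`: the quadratic is affine with slope `-2A ≥ 0`… so `A = 0`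
    have hA : A ≤ 0 := by
      by_contra h
      push Not at h
      have := key ((Q + 1) / (2 * A))
      rw [← hZ, mul_zero, add_zero] at this
      have e : 2 * ((Q + 1) / (2 * A)) * A = Q + 1 := by field_simp
      linarith
    have hA' : A = 0 := le_antisymm hA hA0
    rw [hA', ← hZ]
    simp
  · have h := key (A / Z)
    have e : Q - 2 * (A / Z) * A + (A / Z) ^ 2 * Z = Q - A ^ 2 / Z := by field_simp; ring
    rw [e, sub_nonneg, div_le_iff₀ hZ] at h
    linarith

variable [SFinite M]

/-- **Pair-variance factorisation.**  For `K` with `K`, `K·G`, `K·G²` integrable: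
`∫ K(a)K(b)(G(a) − G(b))² d(M⊗M) = 2(∫K)(∫K G²) − 2(∫K G)²` (Fubini on the three product terms).
[folklore] -/
theorem integral_prod_mul_mul_sq_sub {K G : Ω → ℝ} (hKi : Integrable K M)
    (hKG : Integrable (fun ω => K ω * G ω) M) (hKG2 : Integrable (fun ω => K ω * G ω ^ 2) M) :
    ∫ z, K z.1 * K z.2 * (G z.1 - G z.2) ^ 2 ∂(M.prod M)
      = 2 * ((∫ ω, K ω ∂M) * ∫ ω, K ω * G ω ^ 2 ∂M) - 2 * (∫ ω, K ω * G ω ∂M) ^ 2 := by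
  have e : ∀ z : Ω × Ω, K z.1 * K z.2 * (G z.1 - G z.2) ^ 2
      = (K z.1 * G z.1 ^ 2 * K z.2 - 2 * (K z.1 * G z.1 * (K z.2 * G z.2)))
          + K z.1 * (K z.2 * G z.2 ^ 2) := by
    intro z; ring
  simp_rw [e]
  have i1 : Integrable (fun z : Ω × Ω => K z.1 * G z.1 ^ 2 * K z.2) (M.prod M) := hKG2.mul_prod hKi
  have i2 : Integrable (fun z : Ω × Ω => K z.1 * G z.1 * (K z.2 * G z.2)) (M.prod M) :=
    hKG.mul_prod hKG
  have i3 : Integrable (fun z : Ω × Ω => K z.1 * (K z.2 * G z.2 ^ 2)) (M.prod M) := hKi.mul_prod hKG2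
  have h1 : ∫ z, K z.1 * G z.1 ^ 2 * K z.2 ∂(M.prod M) = (∫ ω, K ω * G ω ^ 2 ∂M) * ∫ ω, K ω ∂M :=
    integral_prod_mul (fun a => K a * G a ^ 2) K
  have h2 : ∫ z, K z.1 * G z.1 * (K z.2 * G z.2) ∂(M.prod M)
      = (∫ ω, K ω * G ω ∂M) * ∫ ω, K ω * G ω ∂M :=
    integral_prod_mul (fun a => K a * G a) (fun b => K b * G b)
  have h3 : ∫ z, K z.1 * (K z.2 * G z.2 ^ 2) ∂(M.prod M) = (∫ ω, K ω ∂M) * ∫ ω, K ω * G ω ^ 2 ∂M :=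
    integral_prod_mul K (fun b => K b * G b ^ 2)
  have i12 : Integrable (fun z : Ω × Ω =>
      K z.1 * G z.1 ^ 2 * K z.2 - 2 * (K z.1 * G z.1 * (K z.2 * G z.2))) (M.prod M) :=
    i1.sub (i2.const_mul _)
  rw [integral_add i12 i3, integral_sub i1 (i2.const_mul _), integral_const_mul, h1, h2, h3]
  ring

end Generic

end Summit.Ventures.LatticeQCDFlow.Theory2
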